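import Literature.MeasureTheory.Group.SL2CoordSetIntegral            -- ★ `iwasawa`, `sMat`, `rotMat`, `xOf`, `yOf`, `coordSet`, `haarSL2pm_coordSet`, `volume_coe_preimage`
import Literature.MeasureTheory.Group.InvariantQuotientNormalized     -- ★ `quotientMeasure`, `fiberLIntegral`, `lintegral_fiberLIntegral_quotientMeasure` (Weil, constant one)
import Mathlib.MeasureTheory.Measure.Lebesgue.Complex
import HarnessLib

/-!
# Hyperbolic (split) orbital measures on `SL₂(ℝ)`: the `K·N` reading of `G ⧸ A` — an abstract unfolding bound for the tree's quotient measure,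
# the Iwasawa coordinates of `g⁻¹ γ g` for a split `γ = diag(a, b)`, and the Haar volume `≤ 8π √R ∕ |a − b|` of the orbit Hilbert–Schmidt cone cut by a slab

Topic `Literature/MeasureTheory/Group`; namespace `Literature.MeasureTheory.Group`.  THEOREMS ONLY (no `def`, no instance, no notation, no axiom, no named
fact, no `sorry`).  Cell `pub/hodgecm-mathlib`, crux H413 (`stmt-HodgeConjecture-24833`), F0∕P3c line LH3 kit (DEAL #11 «(VOL-split-measure)» of LH3-plan (g0),
2026-09-02T03:24:33Z ∕ 03:27:14Z ∕ 03:28:17Z; seat LH2-p04 (g2)): the MEASURE half of the split-class orbit estimate whose matrix half is ★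
`Literature/NumberTheory/Rogawski1990/ArchHyperbolicOrbitHSBall.lean` (p848599): «for a split regular `γ` the orbital measure on `G ⧸ A` read in the `K·N`
coordinates of an Iwasawa decomposition `G = K·N·A` is `dk·dn` up to the constant fixed by the torus measure; the orbit HS-ball `{Σ|(gγg⁻¹)_ij|² ≤ R}` is
`K ×` an `N`-interval of length `≍ √R`, so its quotient volume is `≲ R^{1∕2}`» [BeuzartPlessis2020Asterisque, §1.2 (1.2.2), (1.2.4) p. 21; §1.8 p. 39] — at the exponent
`e = 1∕2` that ★ `Literature/NumberTheory/Rogawski1990/ArchSchwartzOrbitalIntegralConvergence.lean` (p848470, hypothesis `hvol`) consumes.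

THE MATHEMATICS.
* §1 (ABSTRACT, any locally compact second countable group `G`, closed subgroup `H`, the binders of ★ `quotientMeasure H ρ hH ν`).  Weil's formula with constant ONE
  (★ `lintegral_fiberLIntegral_quotientMeasure`) at `f = (1_E ∘ π) · ψ` gives, for ANY Borel weight `ψ ≥ 0` whose `H`-fibres over `E` are `≥ 1`,
  **`μ_{G⧸H}(E) ≤ ∫_G 1_E(gH) ψ(g) dν(g)`** (`quotientMeasure_le_lintegral_of_one_le_fiberLIntegral`), with EQUALITY `μ(E) = κ⁻¹ ∫_G 1_E(gH) ψ dν` when the fibres are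
  constant `= κ ∈ (0, ∞)` (`quotientMeasure_eq_inv_mul_lintegral_of_fiberLIntegral_eq`); and — the form the orbit map `g ↦ g γ g⁻¹` on LEFT cosets `g·C(γ)` wants when
  the coordinates are written for `g⁻¹` — for `ν` inversion invariant and RIGHT fibres `∫_H ψ(h g) dρ ≥ 1`: **`μ(E) ≤ ∫_G 1_E(g⁻¹H) ψ(g) dν(g)`**
  (`quotientMeasure_le_lintegral_inv_of_one_le`).  No section, no fundamental domain, no coordinates on `H`.  (The EQUALITY «`∫_{G⧸A} u = C ∫_K ∫_N u(knA)`» for an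
  abstract Iwasawa decomposition `G = K·N·A` is ★ `Literature/NumberTheory/Automorphic/KNAQuotientIntegration.lean` — cited, not restated; the bound here needs no
  `K`, `N`, only a weight transverse to `H`.)
* §2 (COORDINATES, ambient `M₂(ℝ)`, ★ `SL2IwasawaHaar`: `iwasawa (z, θ) = s(z) k(θ)`, `s(x+iy) = ñ(x) ã(y)`).  For a split `γ = diag(a, b)`:
  **`(s(z)k(θ))⁻¹ · diag(a,b) · s(z)k(θ) = k(θ)⁻¹ · (a, (a−b)x∕y; 0, b) · k(θ)`** (`iwasawa_mul_conj_eq`, `inv_iwasawa_mul_diagonal_mul_iwasawa`: the `A`-part `ã(y)` of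
  `s(z)` only RESCALES the unipotent coordinate, the `K`-part is invisible to the Frobenius (Hilbert–Schmidt) form, `hs_rotMat_mul`, `hs_mul_rotMat`), hence
  **`Σ ((g⁻¹ γ g)_ij)² = a² + b² + (a−b)² (x(g)∕y(g))²`** for `det g = 1` (`hs_inv_conj_diagonal_eq`): the pulled-back orbit HS-ball is the CONE `|x| ≤ c_R y`,
  `c_R ≤ √R ∕ |a−b|` (`abs_xOf_le_of_hs_conj_le`) — dilation invariant, as it must be (the dilations `z ↦ τ²z` are the left translations by `A = {diag(τ, τ⁻¹)}`,
  `yOf_diagonal_mul`, `xOf_diagonal_mul`).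
* §3 (VOLUME).  Cutting the cone by the SLAB `1 ≤ y(g) ≤ 2` — transverse to `A`: each `A`-orbit meets it in the `dτ∕τ`-interval `[y^{-1∕2}, (2∕y)^{1∕2}]` of log-length
  `(log 2)∕2` (`slab_diagonal_mul_iff`) — leaves a subset of the coordinate box `{|Re| ≤ 2√R∕|a−b|, 1 ≤ Im ≤ 2} × (ℝ∕2πℤ)`, of `haarSL2pm`-volume (★ `haarSL2pm_coordSet`,
  `y⁻² ≤ 1` on the box) **`≤ 8π √R ∕ |a − b|`** (`haarSL2pm_hsConjCone_slab_le`).  With §1 (ψ = the slab indicator, fibres constant by left invariance of the torus measure)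
  this is the `R^{1∕2}`-growth of the quotient volume of split orbit HS-balls; the GROUP-LEVEL head over ★ `quotientMeasure` on the `U(Φ₂)`∕`SL₂` subtype needs in
  addition only the identification «Haar on the subtype = κ · pull-back of ★ `haarSL2pm`∕★ `archPlaneLiftMeasure`» ((T2e), LH3-p02's lane) and is filed separately.
ED. 2 (docstring-only): sub-locators re-pinned per lit4-(205)∕(210) L3-BP1∕L3-B2 (Beuzart-Plessis §1.8 p. 39, §1.2 (1.2.2)∕(1.2.4) p. 21; Borel §2.9); no statement or proof byte changed.
HONEST LABEL: HC_CM is proved only modulo the 7 printed citations (2 remaining: hLiu418 = stmt-HodgeConjecture-24832, h413 = stmt-HodgeConjecture-24833) until rung 0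
closes; this file closes no organ — it is kit under the LETTERS O1∕O3 of `stub_N9` and O1″∕O3″ of `stub_N8` ((VOL) ⟹ (CONV), A3-hardening).

## References
* [BeuzartPlessis2020Asterisque] R. Beuzart-Plessis, *A local trace formula for the Gan–Gross–Prasad conjecture for unitary groups: the archimedean case*,
  Astérisque 418 (2020), §1.8 p. 39 (absolute convergence of Schwartz orbital integrals at regular semisimple elements); §1.2 (1.2.2), (1.2.4) p. 21 (orbit-norm equivalence, Harish-Chandra's estimate).
* [Folland1995] G. B. Folland, *A Course in Abstract Harmonic Analysis* (1995), §2.6 Thm. 2.49, (2.52) (Weil's formula on `G ⧸ H`).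
* [Lang1985SL2] S. Lang, *SL₂(ℝ)*, GTM 105 (1985), Ch. III §1 (Iwasawa coordinates, `dg = y⁻² dx dy dθ`), Ch. VII §1 (split orbital integrals in `K·N` coordinates). [folklore]
-/

set_option autoImplicit false

noncomputable section

open MeasureTheory Complex Set
open scoped MatrixGroups Real UpperHalfPlane ENNReal

namespace Literature.MeasureTheory.Group

/-! ## §1 Abstract: bounding the quotient measure of a set through a weight with fibres `≥ 1` -/

section Abstract

variable {G : Type*} [Group G] [TopologicalSpace G] [IsTopologicalGroup G] [LocallyCompactSpace G]
  [SecondCountableTopology G] [T2Space G] [MeasurableSpace G] [BorelSpace G]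
  (H : Subgroup G) [hH : IsClosed (H : Set G)]
  (ρ : Measure H) [ρ.IsMulLeftInvariant] [IsFiniteMeasureOnCompacts ρ] [ρ.IsOpenPosMeasure] [ρ.IsInvInvariant] [SFinite ρ]
  (ν : Measure G) [Measure.IsHaarMeasure ν] [ν.IsMulRightInvariant]
  [MeasurableSpace (G ⧸ H)] [BorelSpace (G ⧸ H)]

/-- **Quotient volume through a weight with fibres at least one.**  For the tree's quotient measure `μ = quotientMeasure H ρ ν` on `G ⧸ H`, a Borel set `E ⊆ G ⧸ H`
and ANY Borel `ψ : G → [0, ∞]` with `∫_H ψ(g h) dρ(h) ≥ 1` whenever `gH ∈ E`:  `μ(E) ≤ ∫_G 1_E(gH) · ψ(g) dν(g)` — Weil's formula (constant one) at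
`f = (1_E ∘ π) · ψ`. [cite: Folland1995, §2.6 Thm. 2.49] -/
theorem quotientMeasure_le_lintegral_of_one_le_fiberLIntegral {E : Set (G ⧸ H)} (hE : MeasurableSet E)
    {ψ : G → ℝ≥0∞} (hψ : Measurable ψ)
    (h1 : ∀ g : G, (QuotientGroup.mk g : G ⧸ H) ∈ E → 1 ≤ ∫⁻ h : H, ψ (g * h) ∂ρ) :
    quotientMeasure H ρ hH ν E ≤ ∫⁻ g, E.indicator 1 (QuotientGroup.mk g : G ⧸ H) * ψ g ∂ν := by
  have hmk : Measurable (QuotientGroup.mk : G → G ⧸ H) := (measurable_quotient_iff (H := H) hH).1 measurable_id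
  have hEi : Measurable (E.indicator (1 : G ⧸ H → ℝ≥0∞)) := measurable_const.indicator hE
  have hprod : Measurable fun g : G => ψ g * E.indicator 1 (QuotientGroup.mk g : G ⧸ H) := hψ.mul (hEi.comp hmk)
  calc quotientMeasure H ρ hH ν E
      = ∫⁻ x, E.indicator 1 x ∂quotientMeasure H ρ hH ν := (lintegral_indicator_one hE).symm
    _ ≤ ∫⁻ x, fiberLIntegral H ρ ψ x * E.indicator 1 x ∂quotientMeasure H ρ hH ν := by
        refine lintegral_mono fun x => ?_
        induction x using QuotientGroup.induction_on with
        | H g =>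
          by_cases hg : (QuotientGroup.mk g : G ⧸ H) ∈ E
          · rw [Set.indicator_of_mem hg, Pi.one_apply, mul_one, fiberLIntegral_mk]
            exact h1 g hg
          · rw [Set.indicator_of_notMem hg]
            exact bot_le
    _ = ∫⁻ x, fiberLIntegral H ρ (fun g => ψ g * E.indicator 1 (QuotientGroup.mk g : G ⧸ H)) x ∂quotientMeasure H ρ hH ν := by
        congr 1
        funext x
        rw [fiberLIntegral_mul_comp_mk H ρ hψ]
    _ = ∫⁻ g, ψ g * E.indicator 1 (QuotientGroup.mk g : G ⧸ H) ∂ν := lintegral_fiberLIntegral_quotientMeasure H ρ ν hprod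
    _ = ∫⁻ g, E.indicator 1 (QuotientGroup.mk g : G ⧸ H) * ψ g ∂ν := by
        congr 1; funext g; rw [mul_comm]

/-- **Exact unfolding through a weight with constant fibres** (the «`K·N` reading» of a quotient measure): if `∫_H ψ(g h) dρ(h) = κ` for EVERY `g`, with
`0 < κ < ∞`, then `μ(E) = κ⁻¹ · ∫_G 1_E(gH) ψ(g) dν(g)` for every Borel `E ⊆ G ⧸ H`. [cite: Folland1995, §2.6 Thm. 2.49] -/
theorem quotientMeasure_eq_inv_mul_lintegral_of_fiberLIntegral_eq {E : Set (G ⧸ H)} (hE : MeasurableSet E)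
    {ψ : G → ℝ≥0∞} (hψ : Measurable ψ) {κ : ℝ≥0∞} (hκ0 : κ ≠ 0) (hκ : κ ≠ ∞)
    (h1 : ∀ g : G, ∫⁻ h : H, ψ (g * h) ∂ρ = κ) :
    quotientMeasure H ρ hH ν E = κ⁻¹ * ∫⁻ g, E.indicator 1 (QuotientGroup.mk g : G ⧸ H) * ψ g ∂ν := by
  have hmk : Measurable (QuotientGroup.mk : G → G ⧸ H) := (measurable_quotient_iff (H := H) hH).1 measurable_id
  have hEi : Measurable (E.indicator (1 : G ⧸ H → ℝ≥0∞)) := measurable_const.indicator hE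
  have hprod : Measurable fun g : G => ψ g * E.indicator 1 (QuotientGroup.mk g : G ⧸ H) := hψ.mul (hEi.comp hmk)
  have key : κ * quotientMeasure H ρ hH ν E = ∫⁻ g, E.indicator 1 (QuotientGroup.mk g : G ⧸ H) * ψ g ∂ν := by
    calc κ * quotientMeasure H ρ hH ν E
        = ∫⁻ x, κ * E.indicator 1 x ∂quotientMeasure H ρ hH ν := by
          rw [lintegral_const_mul _ hEi, lintegral_indicator_one hE]
      _ = ∫⁻ x, fiberLIntegral H ρ ψ x * E.indicator 1 x ∂quotientMeasure H ρ hH ν := by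
          congr 1
          funext x
          induction x using QuotientGroup.induction_on with
          | H g => rw [fiberLIntegral_mk, h1 g]
      _ = ∫⁻ x, fiberLIntegral H ρ (fun g => ψ g * E.indicator 1 (QuotientGroup.mk g : G ⧸ H)) x ∂quotientMeasure H ρ hH ν := by
          congr 1
          funext x
          rw [fiberLIntegral_mul_comp_mk H ρ hψ]
      _ = ∫⁻ g, ψ g * E.indicator 1 (QuotientGroup.mk g : G ⧸ H) ∂ν := lintegral_fiberLIntegral_quotientMeasure H ρ ν hprod
      _ = ∫⁻ g, E.indicator 1 (QuotientGroup.mk g : G ⧸ H) * ψ g ∂ν := by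
          congr 1; funext g; rw [mul_comm]
  rw [← key, ← mul_assoc, ENNReal.inv_mul_cancel hκ0 hκ, one_mul]

/-- **The inverted form** (for the orbit map `g ↦ g γ g⁻¹` on left cosets, whose coordinates are naturally written for `g⁻¹`): if `ν` is also inversion
invariant and the RIGHT fibres satisfy `∫_H ψ(h g) dρ(h) ≥ 1` for every `g`, then `μ(E) ≤ ∫_G 1_E(g⁻¹H) ψ(g) dν(g)` (apply the direct form to `ψ ∘ inv`, using
`(g h)⁻¹ = h⁻¹ g⁻¹` and the inversion invariance of `ρ`, then substitute `g ↦ g⁻¹` under `ν`). [cite: Folland1995, §2.6 Thm. 2.49] -/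
theorem quotientMeasure_le_lintegral_inv_of_one_le [ν.IsInvInvariant] {E : Set (G ⧸ H)} (hE : MeasurableSet E)
    {ψ : G → ℝ≥0∞} (hψ : Measurable ψ)
    (h1 : ∀ g : G, 1 ≤ ∫⁻ h : H, ψ ((h : G) * g) ∂ρ) :
    quotientMeasure H ρ hH ν E ≤ ∫⁻ g, E.indicator 1 (QuotientGroup.mk g⁻¹ : G ⧸ H) * ψ g ∂ν := by
  have hmk : Measurable (QuotientGroup.mk : G → G ⧸ H) := (measurable_quotient_iff (H := H) hH).1 measurable_id
  have hEi : Measurable (E.indicator (1 : G ⧸ H → ℝ≥0∞)) := measurable_const.indicator hE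
  have hψ' : Measurable fun g : G => ψ g⁻¹ := hψ.comp measurable_inv
  -- fibres of `ψ ∘ inv` over left cosets are right fibres of `ψ`
  have h1' : ∀ g : G, (QuotientGroup.mk g : G ⧸ H) ∈ E → 1 ≤ ∫⁻ h : H, (fun x : G => ψ x⁻¹) (g * h) ∂ρ := by
    intro g _
    have hmeas : Measurable (fun k : H => ψ ((k : G) * g⁻¹)) :=
      hψ.comp ((continuous_subtype_val.mul continuous_const).measurable)
    have key := (Measure.measurePreserving_inv ρ).lintegral_comp hmeas
    simp only [Subgroup.coe_inv] at key
    simp only [mul_inv_rev]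
    rw [key]
    exact h1 g⁻¹
  refine (quotientMeasure_le_lintegral_of_one_le_fiberLIntegral H ρ ν hE hψ' h1').trans (le_of_eq ?_)
  -- substitute `g ↦ g⁻¹` under the inversion-invariant `ν`
  have hF : Measurable fun g : G => E.indicator 1 (QuotientGroup.mk g⁻¹ : G ⧸ H) * ψ g :=
    ((hEi.comp hmk).comp measurable_inv).mul hψ
  have := (Measure.measurePreserving_inv ν).lintegral_comp hF
  simp only [inv_inv] at this
  exact this

end Abstract

/-! ## §2 Iwasawa coordinates of `g⁻¹ · diag(a, b) · g` -/

section Coordinates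

/-- `k(θ) k(−θ) = 1`. [folklore] -/
private theorem rotMat_mul_rotMat_neg (θ : AddCircle (2 * π)) : rotMat θ * rotMat (-θ) = 1 := by
  rw [← rotMat_add, add_neg_cancel, rotMat_zero]

/-- `k(−θ) k(θ) = 1`. [folklore] -/
private theorem rotMat_neg_mul_rotMat (θ : AddCircle (2 * π)) : rotMat (-θ) * rotMat θ = 1 := by
  rw [← rotMat_add, neg_add_cancel, rotMat_zero]

/-- The `A`-part of `s(z) = ñ(x) ã(y)` rescales the unipotent coordinate: `s(z) · (a, (a−b) x∕y; 0, b) = diag(a, b) · s(z)` for `z = x + iy`. [folklore] -/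
private theorem sMat_mul_upper_eq_diagonal_mul_sMat (z : ℍ) (a b : ℝ) :
    sMat z * !![a, (a - b) * (z.re / z.im); 0, b] = !![a, 0; 0, b] * sMat z := by
  obtain ⟨r, hr0, hyr⟩ : ∃ r : ℝ, 0 < r ∧ z.im = r ^ 2 :=
    ⟨Real.sqrt z.im, Real.sqrt_pos.2 z.im_pos, (Real.sq_sqrt z.im_pos.le).symm⟩
  have hr : r ≠ 0 := hr0.ne'
  ext i j
  have h : r * r⁻¹ = 1 := mul_inv_cancel₀ hr
  fin_cases i <;> fin_cases j <;> simp [sMat, Matrix.mul_apply, Fin.sum_univ_two, hyr, Real.sqrt_sq hr0.le] <;>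
    first | ring1 | linear_combination (a - b) * z.re * r⁻¹ * h

/-- **`s(z)k(θ) · (k(θ)⁻¹ (a, (a−b)x∕y; 0, b) k(θ)) = diag(a, b) · s(z)k(θ)`** — the conjugation identity behind the `K·N` reading of a split orbit, stated without
inverses. [folklore] -/
private theorem iwasawa_mul_conj_eq (z : ℍ) (θ : AddCircle (2 * π)) (a b : ℝ) :
    iwasawa (z, θ) * (rotMat (-θ) * !![a, (a - b) * (z.re / z.im); 0, b] * rotMat θ) = !![a, 0; 0, b] * iwasawa (z, θ) := by
  simp only [iwasawa]
  calc sMat z * rotMat θ * (rotMat (-θ) * !![a, (a - b) * (z.re / z.im); 0, b] * rotMat θ)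
      = sMat z * (rotMat θ * rotMat (-θ)) * !![a, (a - b) * (z.re / z.im); 0, b] * rotMat θ := by
        simp only [Matrix.mul_assoc]
    _ = (sMat z * !![a, (a - b) * (z.re / z.im); 0, b]) * rotMat θ := by rw [rotMat_mul_rotMat_neg, Matrix.mul_one]
    _ = !![a, 0; 0, b] * (sMat z * rotMat θ) := by rw [sMat_mul_upper_eq_diagonal_mul_sMat, Matrix.mul_assoc]

/-- **`(s(z)k(θ))⁻¹ · diag(a, b) · s(z)k(θ) = k(−θ) · (a, (a−b)x∕y; 0, b) · k(θ)`**: conjugating a split element by `g = s(z)k(θ)` and reading it from the right,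
the `A`-coordinate `y` only rescales the unipotent coordinate `x` and the `K`-coordinate conjugates by a rotation. [cite: BeuzartPlessis2020Asterisque, §1.5 p. 31] -/
theorem inv_iwasawa_mul_diagonal_mul_iwasawa (z : ℍ) (θ : AddCircle (2 * π)) (a b : ℝ) :
    (iwasawa (z, θ))⁻¹ * !![a, 0; 0, b] * iwasawa (z, θ) = rotMat (-θ) * !![a, (a - b) * (z.re / z.im); 0, b] * rotMat θ := by
  have hdet : IsUnit (iwasawa (z, θ)).det := by rw [det_iwasawa]; exact isUnit_one
  calc (iwasawa (z, θ))⁻¹ * !![a, 0; 0, b] * iwasawa (z, θ)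
      = (iwasawa (z, θ))⁻¹ * (!![a, 0; 0, b] * iwasawa (z, θ)) := Matrix.mul_assoc _ _ _
    _ = (iwasawa (z, θ))⁻¹ * (iwasawa (z, θ) * (rotMat (-θ) * !![a, (a - b) * (z.re / z.im); 0, b] * rotMat θ)) := by
        rw [iwasawa_mul_conj_eq]
    _ = rotMat (-θ) * !![a, (a - b) * (z.re / z.im); 0, b] * rotMat θ := by
        rw [← Matrix.mul_assoc, Matrix.nonsing_inv_mul _ hdet, Matrix.one_mul]

/-- The Frobenius (Hilbert–Schmidt) form `Σ M_ij²` is invariant under LEFT multiplication by a rotation. [folklore] -/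
private theorem hs_rotMat_mul (θ : AddCircle (2 * π)) (M : Matrix (Fin 2) (Fin 2) ℝ) :
    ∑ i : Fin 2, ∑ j : Fin 2, (rotMat θ * M) i j ^ 2 = ∑ i : Fin 2, ∑ j : Fin 2, M i j ^ 2 := by
  have hcs := cosA_sq_add_sinA_sq θ
  simp only [rotMat, Matrix.mul_apply, Fin.sum_univ_two, Matrix.of_apply, Matrix.cons_val', Matrix.cons_val_zero, Matrix.cons_val_one,
    Matrix.empty_val', Matrix.cons_val_fin_one]
  linear_combination (M 0 0 ^ 2 + M 0 1 ^ 2 + M 1 0 ^ 2 + M 1 1 ^ 2) * hcs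

/-- The Frobenius (Hilbert–Schmidt) form `Σ M_ij²` is invariant under RIGHT multiplication by a rotation. [folklore] -/
private theorem hs_mul_rotMat (θ : AddCircle (2 * π)) (M : Matrix (Fin 2) (Fin 2) ℝ) :
    ∑ i : Fin 2, ∑ j : Fin 2, (M * rotMat θ) i j ^ 2 = ∑ i : Fin 2, ∑ j : Fin 2, M i j ^ 2 := by
  have hcs := cosA_sq_add_sinA_sq θ
  simp only [rotMat, Matrix.mul_apply, Fin.sum_univ_two, Matrix.of_apply, Matrix.cons_val', Matrix.cons_val_zero, Matrix.cons_val_one,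
    Matrix.empty_val', Matrix.cons_val_fin_one]
  linear_combination (M 0 0 ^ 2 + M 0 1 ^ 2 + M 1 0 ^ 2 + M 1 1 ^ 2) * hcs

/-- **`Σ ((s(z)k(θ))⁻¹ diag(a,b) s(z)k(θ))_ij² = a² + b² + (a−b)² (x∕y)²`** — along the pulled-back split orbit the Hilbert–Schmidt norm is an exact quadratic in the
cone coordinate `x∕y`. [cite: BeuzartPlessis2020Asterisque, §1.5 p. 31] -/
theorem hs_inv_iwasawa_conj_diagonal (z : ℍ) (θ : AddCircle (2 * π)) (a b : ℝ) :
    ∑ i : Fin 2, ∑ j : Fin 2, ((iwasawa (z, θ))⁻¹ * !![a, 0; 0, b] * iwasawa (z, θ)) i j ^ 2 = a ^ 2 + b ^ 2 + (a - b) ^ 2 * (z.re / z.im) ^ 2 := by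
  rw [inv_iwasawa_mul_diagonal_mul_iwasawa, hs_mul_rotMat, hs_rotMat_mul]
  simp [Fin.sum_univ_two]
  ring

/-- The same for any `g` with `det g = 1`, in the coordinates `x(g)`, `y(g)` of ★ `SL2IwasawaHaar`: **`Σ ((g⁻¹ diag(a,b) g)_ij)² = a² + b² + (a−b)² (x(g)∕y(g))²`**.
[cite: BeuzartPlessis2020Asterisque, §1.5 p. 31] -/
theorem hs_inv_conj_diagonal_eq {g : Matrix (Fin 2) (Fin 2) ℝ} (hg : g.det = 1) (a b : ℝ) :
    ∑ i : Fin 2, ∑ j : Fin 2, (g⁻¹ * !![a, 0; 0, b] * g) i j ^ 2 = a ^ 2 + b ^ 2 + (a - b) ^ 2 * (xOf g / yOf g) ^ 2 := by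
  have hmem : g ∈ Set.range iwasawa := by rw [range_iwasawa]; exact hg
  obtain ⟨⟨z, θ⟩, rfl⟩ := hmem
  rw [hs_inv_iwasawa_conj_diagonal, xOf_iwasawa, yOf_iwasawa]

/-- **The pulled-back orbit HS-ball is a cone**: for `det g = 1`, `a ≠ b` and `Σ ((g⁻¹ diag(a,b) g)_ij)² ≤ R`, `|x(g)| ≤ (√R ∕ |a − b|) · y(g)`.
[cite: BeuzartPlessis2020Asterisque, §1.8 p. 39; §1.2 (1.2.2), (1.2.4) p. 21] -/
theorem abs_xOf_le_of_hs_conj_le {g : Matrix (Fin 2) (Fin 2) ℝ} (hg : g.det = 1) {a b R : ℝ} (hab : a ≠ b)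
    (h : ∑ i : Fin 2, ∑ j : Fin 2, (g⁻¹ * !![a, 0; 0, b] * g) i j ^ 2 ≤ R) :
    |xOf g| ≤ Real.sqrt R / |a - b| * yOf g := by
  have hmem : g ∈ Set.range iwasawa := by rw [range_iwasawa]; exact hg
  obtain ⟨⟨z, θ⟩, rfl⟩ := hmem
  rw [hs_inv_iwasawa_conj_diagonal] at h
  rw [xOf_iwasawa, yOf_iwasawa]
  have hy : 0 < z.im := z.im_pos
  have hab' : 0 < |a - b| := abs_pos.2 (sub_ne_zero.2 hab)
  -- `((a-b) x / y)² ≤ R`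
  have h2 : ((a - b) * (z.re / z.im)) ^ 2 ≤ R := by nlinarith [sq_nonneg a, sq_nonneg b]
  have h3 : |(a - b) * (z.re / z.im)| ≤ Real.sqrt R := Real.abs_le_sqrt h2
  rw [abs_mul, abs_div, abs_of_pos hy] at h3
  rw [div_mul_eq_mul_div, le_div_iff₀ hab']
  have := mul_le_mul_of_nonneg_right h3 hy.le
  calc |z.re| * |a - b| = |a - b| * (|z.re| / z.im) * z.im := by field_simp
    _ ≤ Real.sqrt R * z.im := this

/-- Left translation by the split torus `diag(τ, τ⁻¹)` DILATES the coordinate `y`: `y(diag(τ, τ⁻¹) g) = τ² y(g)` (the torus direction of the orbit cone).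
[cite: BeuzartPlessis2020Asterisque, §1.8 p. 39; §1.2 (1.2.2), (1.2.4) p. 21] -/
theorem yOf_diagonal_mul {τ : ℝ} (hτ : τ ≠ 0) (g : Matrix (Fin 2) (Fin 2) ℝ) :
    yOf (!![τ, 0; 0, τ⁻¹] * g) = τ ^ 2 * yOf g := by
  unfold yOf
  rw [Matrix.det_mul, Matrix.det_fin_two_of]
  simp [Matrix.mul_apply, Fin.sum_univ_two]
  by_cases h0 : g 1 0 ^ 2 + g 1 1 ^ 2 = 0
  · have hc : g 1 0 = 0 := by nlinarith [sq_nonneg (g 1 0), sq_nonneg (g 1 1)]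
    have hd : g 1 1 = 0 := by nlinarith [sq_nonneg (g 1 0), sq_nonneg (g 1 1)]
    simp [hc, hd]
  · field_simp

/-- Left translation by the split torus dilates the coordinate `x` as well: `x(diag(τ, τ⁻¹) g) = τ² x(g)` (so the cone `|x| ≤ c y` is torus-stable).
[cite: BeuzartPlessis2020Asterisque, §1.8 p. 39; §1.2 (1.2.2), (1.2.4) p. 21] -/
theorem xOf_diagonal_mul {τ : ℝ} (hτ : τ ≠ 0) (g : Matrix (Fin 2) (Fin 2) ℝ) :
    xOf (!![τ, 0; 0, τ⁻¹] * g) = τ ^ 2 * xOf g := by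
  unfold xOf
  simp [Matrix.mul_apply, Fin.sum_univ_two]
  by_cases h0 : g 1 0 ^ 2 + g 1 1 ^ 2 = 0
  · have hc : g 1 0 = 0 := by nlinarith [sq_nonneg (g 1 0), sq_nonneg (g 1 1)]
    have hd : g 1 1 = 0 := by nlinarith [sq_nonneg (g 1 0), sq_nonneg (g 1 1)]
    simp [hc, hd]
  · field_simp

/-- **The slab `1 ≤ y ≤ 2` is transverse to the split torus**: for `y(g) > 0` and `τ > 0`, `diag(τ, τ⁻¹) g` lies in the slab iff `τ ∈ [y(g)^{-1∕2}, (2∕y(g))^{1∕2}]` — an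
interval of `dτ∕τ`-length `(log 2)∕2`, independent of `g`. [cite: BeuzartPlessis2020Asterisque, §1.8 p. 39; §1.2 (1.2.2), (1.2.4) p. 21] -/
theorem slab_diagonal_mul_iff {g : Matrix (Fin 2) (Fin 2) ℝ} (hg : 0 < yOf g) {τ : ℝ} (hτ : 0 < τ) :
    (1 ≤ yOf (!![τ, 0; 0, τ⁻¹] * g) ∧ yOf (!![τ, 0; 0, τ⁻¹] * g) ≤ 2) ↔ τ ∈ Set.Icc (1 / Real.sqrt (yOf g)) (Real.sqrt (2 / yOf g)) := by
  rw [yOf_diagonal_mul hτ.ne', Set.mem_Icc]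
  have hs : 0 < Real.sqrt (yOf g) := Real.sqrt_pos.2 hg
  have hs2 : Real.sqrt (yOf g) ^ 2 = yOf g := Real.sq_sqrt hg.le
  have ht : 0 < τ * Real.sqrt (yOf g) := mul_pos hτ hs
  have e : (τ * Real.sqrt (yOf g)) * (τ * Real.sqrt (yOf g)) = τ ^ 2 * yOf g := by
    linear_combination τ ^ 2 * hs2
  constructor
  · rintro ⟨h1, h2⟩
    refine ⟨?_, ?_⟩
    · rw [div_le_iff₀ hs]
      have h1' : 1 ≤ (τ * Real.sqrt (yOf g)) * (τ * Real.sqrt (yOf g)) := by rw [e]; exact h1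
      nlinarith [ht, h1']
    · have h2' : τ ^ 2 ≤ 2 / yOf g := by rw [le_div_iff₀ hg]; exact h2
      exact le_trans (le_abs_self τ) (Real.abs_le_sqrt h2')
  · rintro ⟨h1, h2⟩
    refine ⟨?_, ?_⟩
    · rw [div_le_iff₀ hs] at h1
      have h1' := mul_self_le_mul_self zero_le_one h1
      rw [one_mul, e] at h1'
      exact h1'
    · have h2' := mul_self_le_mul_self hτ.le h2
      rw [Real.mul_self_sqrt (by positivity), ← sq, le_div_iff₀ hg] at h2'
      exact h2'

end Coordinates

/-! ## §3 The Haar volume of the orbit HS-cone cut by the slab `1 ≤ y ≤ 2` -/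

section Volume

variable [MeasurableSpace (Matrix (Fin 2) (Fin 2) ℝ)] [BorelSpace (Matrix (Fin 2) (Fin 2) ℝ)]

omit [MeasurableSpace (Matrix (Fin 2) (Fin 2) ℝ)] [BorelSpace (Matrix (Fin 2) (Fin 2) ℝ)] in
/-- **CONE ∩ SLAB ⊆ COORDINATE BOX**: `{det g = 1, Σ((g⁻¹ diag(a,b) g)_ij)² ≤ R, 1 ≤ y(g) ≤ 2} ⊆ coordSet {|Re| ≤ 2√R∕|a−b|, 1 ≤ Im ≤ 2} univ`.
[cite: BeuzartPlessis2020Asterisque, §1.8 p. 39; §1.2 (1.2.2), (1.2.4) p. 21] -/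
theorem hsConjCone_slab_subset_coordSet {a b : ℝ} (hab : a ≠ b) (R : ℝ) :
    {g : Matrix (Fin 2) (Fin 2) ℝ | g.det = 1 ∧ ∑ i : Fin 2, ∑ j : Fin 2, (g⁻¹ * !![a, 0; 0, b] * g) i j ^ 2 ≤ R ∧ 1 ≤ yOf g ∧ yOf g ≤ 2} ⊆
      coordSet {w : ℂ | |w.re| ≤ 2 * (Real.sqrt R / |a - b|) ∧ 1 ≤ w.im ∧ w.im ≤ 2} (univ : Set (AddCircle (2 * π))) := by
  rintro g ⟨hg, hR, hy1, hy2⟩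
  refine ⟨hg, ⟨?_, hy1, hy2⟩, mem_univ _⟩
  have h := abs_xOf_le_of_hs_conj_le hg hab hR
  have hc : 0 ≤ Real.sqrt R / |a - b| := div_nonneg (Real.sqrt_nonneg R) (abs_nonneg _)
  change |xOf g| ≤ 2 * (Real.sqrt R / |a - b|)
  calc |xOf g| ≤ Real.sqrt R / |a - b| * yOf g := h
    _ ≤ Real.sqrt R / |a - b| * 2 := mul_le_mul_of_nonneg_left hy2 hc
    _ = 2 * (Real.sqrt R / |a - b|) := mul_comm _ _

omit [MeasurableSpace (Matrix (Fin 2) (Fin 2) ℝ)] [BorelSpace (Matrix (Fin 2) (Fin 2) ℝ)] in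
/-- The coordinate box is measurable. [folklore] -/
private theorem measurableSet_coneBox (c : ℝ) : MeasurableSet {w : ℂ | |w.re| ≤ c ∧ 1 ≤ w.im ∧ w.im ≤ 2} :=
  (measurableSet_le (continuous_abs.measurable.comp Complex.continuous_re.measurable) measurable_const).inter
    ((measurableSet_le measurable_const Complex.continuous_im.measurable).inter
      (measurableSet_le Complex.continuous_im.measurable measurable_const))

omit [MeasurableSpace (Matrix (Fin 2) (Fin 2) ℝ)] [BorelSpace (Matrix (Fin 2) (Fin 2) ℝ)] in
/-- **The hyperbolic area of the box `{|Re| ≤ c, 1 ≤ Im ≤ 2}` is at most `2c`** (`y⁻² ≤ 1` on the box, whose Lebesgue area is `2c · 1`). [folklore] -/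
private theorem volume_coneBox_le {c : ℝ} (hc : 0 ≤ c) :
    volume (((↑) : ℍ → ℂ) ⁻¹' {w : ℂ | |w.re| ≤ c ∧ 1 ≤ w.im ∧ w.im ≤ 2}) ≤ ENNReal.ofReal (2 * c) := by
  have hm := measurableSet_coneBox c
  have hpos : {w : ℂ | |w.re| ≤ c ∧ 1 ≤ w.im ∧ w.im ≤ 2} ⊆ {w : ℂ | 0 < w.im} := fun w hw => lt_of_lt_of_le one_pos hw.2.1
  rw [volume_coe_preimage hm hpos]
  -- `y⁻² ≤ 1` on the box
  have hle : ∫⁻ w in {w : ℂ | |w.re| ≤ c ∧ 1 ≤ w.im ∧ w.im ≤ 2}, ENNReal.ofReal (1 / w.im ^ 2) ∂volume ≤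
      ∫⁻ _ in {w : ℂ | |w.re| ≤ c ∧ 1 ≤ w.im ∧ w.im ≤ 2}, 1 ∂volume := by
    refine setLIntegral_mono measurable_const fun w hw => ?_
    have h1 : 1 ≤ w.im ^ 2 := by nlinarith [hw.2.1]
    rw [← ENNReal.ofReal_one]
    exact ENNReal.ofReal_le_ofReal ((div_le_one (by positivity)).2 h1)
  refine hle.trans ?_
  rw [setLIntegral_one]
  -- Lebesgue area of the box through `ℂ ≃ ℝ × ℝ`
  have hmp := Complex.volume_preserving_equiv_real_prod.symm
  rw [← hmp.measure_preimage hm.nullMeasurableSet]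
  have hpre : Complex.measurableEquivRealProd.symm ⁻¹' {w : ℂ | |w.re| ≤ c ∧ 1 ≤ w.im ∧ w.im ≤ 2} = Set.Icc (-c) c ×ˢ Set.Icc 1 2 := by
    ext p
    simp only [Set.mem_preimage, Set.mem_setOf_eq, Complex.measurableEquivRealProd_symm_apply, abs_le, Set.mem_prod, Set.mem_Icc]
  rw [hpre, Measure.volume_eq_prod, Measure.prod_prod, Real.volume_Icc, Real.volume_Icc, ← ENNReal.ofReal_mul (by linarith)]
  apply le_of_eq
  congr 1
  ring

omit [MeasurableSpace (Matrix (Fin 2) (Fin 2) ℝ)] [BorelSpace (Matrix (Fin 2) (Fin 2) ℝ)] in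
omit [MeasurableSpace (Matrix (Fin 2) (Fin 2) ℝ)] [BorelSpace (Matrix (Fin 2) (Fin 2) ℝ)] in
/-- On `det g = 1` the inverse is the adjugate `(d, −b; −c, a)`, so the cone condition is a polynomial inequality. [folklore] -/
private theorem inv_eq_of_det_one {g : Matrix (Fin 2) (Fin 2) ℝ} (hg : g.det = 1) : g⁻¹ = !![g 1 1, -g 0 1; -g 1 0, g 0 0] := by
  rw [Matrix.inv_def, hg, Ring.inverse_one, one_smul, Matrix.adjugate_fin_two]

/-- The set `CONE ∩ SLAB` is measurable (on `det = 1` the inverse is the adjugate, a continuous function of `g`). [cite: BeuzartPlessis2020Asterisque, §1.8 p. 39; §1.2 (1.2.2), (1.2.4) p. 21] -/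
theorem measurableSet_hsConjCone_slab (a b R : ℝ) :
    MeasurableSet {g : Matrix (Fin 2) (Fin 2) ℝ | g.det = 1 ∧ ∑ i : Fin 2, ∑ j : Fin 2, (g⁻¹ * !![a, 0; 0, b] * g) i j ^ 2 ≤ R ∧ 1 ≤ yOf g ∧ yOf g ≤ 2} := by
  have h1 : MeasurableSet {g : Matrix (Fin 2) (Fin 2) ℝ | g.det = 1} :=
    (continuous_id.matrix_det.measurable) (measurableSet_singleton 1)
  have hent : ∀ i j, Continuous fun g : Matrix (Fin 2) (Fin 2) ℝ => g i j := fun i j => Continuous.matrix_elem continuous_id i j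
  -- the adjugate, continuous
  have hadj : Continuous fun g : Matrix (Fin 2) (Fin 2) ℝ => (!![g 1 1, -g 0 1; -g 1 0, g 0 0] : Matrix (Fin 2) (Fin 2) ℝ) := by
    refine continuous_matrix fun i j => ?_
    fin_cases i <;> fin_cases j
    · exact hent 1 1
    · exact (hent 0 1).neg
    · exact (hent 1 0).neg
    · exact hent 0 0
  have hconj : Continuous fun g : Matrix (Fin 2) (Fin 2) ℝ => !![g 1 1, -g 0 1; -g 1 0, g 0 0] * !![a, 0; 0, b] * g :=
    (hadj.matrix_mul continuous_const).matrix_mul continuous_id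
  have hsum : Measurable fun g : Matrix (Fin 2) (Fin 2) ℝ => ∑ i : Fin 2, ∑ j : Fin 2, (!![g 1 1, -g 0 1; -g 1 0, g 0 0] * !![a, 0; 0, b] * g) i j ^ 2 :=
    (continuous_finsetSum _ fun i _ => continuous_finsetSum _ fun j _ => (hconj.matrix_elem i j).pow 2).measurable
  have hy : Measurable yOf := by
    unfold yOf
    exact (continuous_id.matrix_det.measurable).div ((((hent 1 0).pow 2).add ((hent 1 1).pow 2)).measurable)
  -- replace `g⁻¹` by the adjugate on `det = 1`
  have e : {g : Matrix (Fin 2) (Fin 2) ℝ | g.det = 1 ∧ ∑ i : Fin 2, ∑ j : Fin 2, (g⁻¹ * !![a, 0; 0, b] * g) i j ^ 2 ≤ R ∧ 1 ≤ yOf g ∧ yOf g ≤ 2} =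
      {g | g.det = 1} ∩ ({g | ∑ i : Fin 2, ∑ j : Fin 2, (!![g 1 1, -g 0 1; -g 1 0, g 0 0] * !![a, 0; 0, b] * g) i j ^ 2 ≤ R} ∩
        {g | 1 ≤ yOf g ∧ yOf g ≤ 2}) := by
    ext g
    simp only [Set.mem_setOf_eq, Set.mem_inter_iff]
    constructor
    · rintro ⟨hg, hR, hy⟩
      exact ⟨hg, by rw [← inv_eq_of_det_one hg]; exact hR, hy⟩
    · rintro ⟨hg, hR, hy⟩
      exact ⟨hg, by rw [inv_eq_of_det_one hg]; exact hR, hy⟩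
  rw [e]
  exact h1.inter ((measurableSet_le hsum measurable_const).inter
    ((measurableSet_le measurable_const hy).inter (measurableSet_le hy measurable_const)))

/-- **THE VOLUME OF THE SPLIT ORBIT CONE IN A SLAB**: for `a ≠ b` and `R ≥ 0`,
`haarSL2pm {g | det g = 1, Σ((g⁻¹ diag(a,b) g)_ij)² ≤ R, 1 ≤ y(g) ≤ 2} ≤ ofReal (8π √R ∕ |a − b|)` — the `R^{1∕2}` growth (exponent `e = 1∕2`) of the quotient volume
of a split regular orbit HS-ball, read in `K·N` coordinates (cone ∩ slab ⊆ box `{|Re| ≤ 2√R∕|a−b|, 1 ≤ Im ≤ 2} × (ℝ∕2πℤ)` of hyperbolic area `≤ 4√R∕|a−b|`, ★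
`haarSL2pm_coordSet`). [cite: BeuzartPlessis2020Asterisque, §1.8 p. 39; §1.2 (1.2.2), (1.2.4) p. 21] -/
theorem haarSL2pm_hsConjCone_slab_le {a b : ℝ} (hab : a ≠ b) (R : ℝ) :
    haarSL2pm {g : Matrix (Fin 2) (Fin 2) ℝ | g.det = 1 ∧ ∑ i : Fin 2, ∑ j : Fin 2, (g⁻¹ * !![a, 0; 0, b] * g) i j ^ 2 ≤ R ∧ 1 ≤ yOf g ∧ yOf g ≤ 2} ≤
      ENNReal.ofReal (8 * π * Real.sqrt R / |a - b|) := by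
  haveI : Fact (0 < 2 * π) := fact_two_pi_pos
  have hc : 0 ≤ Real.sqrt R / |a - b| := div_nonneg (Real.sqrt_nonneg R) (abs_nonneg _)
  refine (measure_mono (hsConjCone_slab_subset_coordSet hab R)).trans ?_
  rw [haarSL2pm_coordSet (measurableSet_coneBox _) MeasurableSet.univ, AddCircle.measure_univ]
  refine (mul_le_mul' (volume_coneBox_le (by positivity)) le_rfl).trans (le_of_eq ?_)
  rw [← ENNReal.ofReal_mul (by positivity)]
  congr 1
  ring

end Volume

end Literature.MeasureTheory.Group

end
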